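import Mathlib
import HarnessLib
import Summits.CriticalPhenomena.Ising3DConformalLimit.Theses.ArmDressing
import Summits.CriticalPhenomena.Ising3DConformalLimit.Theorems.ArmDressingEvenPatternDecouplingArmBoxLimits
import Summits.CriticalPhenomena.Ising3DConformalLimit.Theorems.ArmDressingEvenPatternDecouplingPatternTransferDet
import Literature.Probability.LatticeModels.RandomClusterDisjointRegionsProduct

/-!
# `ArmDressing.EvenPatternDecoupling` — stub `stub_armsUpperWired` (PROVED)
(route `ArmDressing`, crux item stmt-CriticalPhenomena-16133, line `registered`, skeleton revision 6)

The registered stub [ARM] of the line skeleton of crux B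
(`Summit.CriticalPhenomena.Ising3DConformalLimit.Theses.ArmDressing.EvenPatternDecoupling`): for the
wired critical FK-Ising boxes `Λ_L ↑ ℤ³` (`q = 2`, `p = 1 - e^{-2β_c(3)}`), points `z_j` whose closed
balls `B̄(z_j, 4a)` lie in pairwise disjoint outer balls `B(c_j, r_j)`, eventually as the mesh
`δ → 0⁺`: the infinite-volume probability `Pr` (`limUnder` of the box probabilities) that every
lattice point `z_j^δ` is joined by an open path to the discretised complement of its outer ball
satisfies `0 < Pr ≤ (φ¹_{Λ_N}(0 ↔ ∂Λ_N))^n`, `N = ⌊a/δ⌋₊` (`thetaWiredBox`).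

Proof. (1) The box probabilities converge to a positive limit (`exists_pos_tendsto_armEvent`, the
landed stub `stub_armBoxLimits`: thermodynamic limit of the connection laws and finite energy), so
`Pr` is that limit. (2) Geometry, for `0 < δ ≤ a`: every lattice point `y` of the sup-box
`z_j^δ + Λ_N` has `δy ∈ B̄(z_j, 4a) ⊆ B(c_j, r_j)` (`|δy - δz_j^δ| ≤ 2δN ≤ 2a`, `|δz_j^δ - z_j| ≤ 2δ`),
so an arm from `z_j^δ` to `(B(c_j, r_j)ᶜ)^δ` leaves the sup-box, and the `n` sup-boxes are pairwise
disjoint (they lie in the disjoint outer balls). (3) For `L` large all sup-boxes lie in `Λ_L`, and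
the `φ¹_{Λ_L}`-probability of `n` simultaneous arms out of pairwise disjoint translates of `Λ_N` is
at most `θ¹_N^n` (`Literature.Probability.LatticeModels.rcMeasure_real_siteArms_le_thetaWiredBox_pow`:
domain Markov property with the wired boundary condition maximal, conditionally on everything
outside each box, iterated by successive conditioning; translation invariance). The limit of a
sequence eventually `≤ θ¹_N^n` is `≤ θ¹_N^n`.

References: G. Grimmett, *The Random-Cluster Model* (2006), Lemma (4.13), Lemma (4.14)(b),
Prop. (5.11) (proof), Thm. (4.19); H. Duminil-Copin, S. Smirnov, Clay Math. Proc. 15 (2012), §6.1.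
No definitions, no named facts, no `sorry`.
-/

namespace Summit.CriticalPhenomena.Ising3DConformalLimit.Theorems.EvenPatternDecoupling

open scoped Topology
open Filter Set Metric MeasureTheory
open Literature.Probability.LatticeModels Literature.Probability.Percolation
open Literature.Barriers.CriticalPhenomena

/-! ### Geometry of the sup-box of radius `⌊a/δ⌋₊` about a lattice approximation -/

/-- For `0 < δ ≤ a`, every lattice point `y` of the sup-box of radius `⌊a/δ⌋₊` about `z^δ` has
`δy ∈ B̄(z, 4a)`: `|δy - δz^δ| ≤ 2δ⌊a/δ⌋₊ ≤ 2a` and `|δz^δ - z| ≤ 2δ ≤ 2a`. [folklore] -/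
theorem mesh_mem_closedBall_of_mem_icc {δ a : ℝ} (hδ : 0 < δ) (hδa : δ ≤ a)
    (z : EuclideanSpace ℝ (Fin 3)) {y : Site 3}
    (hy : y ∈ Finset.Icc (fun k => -(⌊a / δ⌋₊ : ℤ) + latticeApprox δ z k)
      (fun k => (⌊a / δ⌋₊ : ℤ) + latticeApprox δ z k)) :
    (WithLp.toLp 2 fun i : Fin 3 => δ * (y i : ℝ) : EuclideanSpace ℝ (Fin 3)) ∈
      closedBall z (4 * a) := by
  have ha : 0 ≤ a := hδ.le.trans hδa
  have hN : δ * (⌊a / δ⌋₊ : ℝ) ≤ a := by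
    have h1 : (⌊a / δ⌋₊ : ℝ) ≤ a / δ := Nat.floor_le (div_nonneg ha hδ.le)
    rw [le_div_iff₀ hδ] at h1
    linarith
  have hd1 : dist (WithLp.toLp 2 fun i : Fin 3 => δ * (y i : ℝ) : EuclideanSpace ℝ (Fin 3))
      (WithLp.toLp 2 fun i : Fin 3 => δ * ((latticeApprox δ z i : ℤ) : ℝ)) ≤ 2 * a := by
    refine dist_euclidean_le_two_mul ha fun k => ?_
    show dist (δ * (y k : ℝ)) (δ * ((latticeApprox δ z k : ℤ) : ℝ)) ≤ a
    have hk := (mem_siteIcc_iff.1 hy) k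
    have h3 : |y k - latticeApprox δ z k| ≤ (⌊a / δ⌋₊ : ℤ) := by
      rw [abs_le]
      constructor <;> omega
    have h4 : |((y k : ℤ) : ℝ) - ((latticeApprox δ z k : ℤ) : ℝ)| ≤ (⌊a / δ⌋₊ : ℝ) := by
      have h5 := (Int.cast_le (R := ℝ)).2 h3
      rw [Int.cast_abs, Int.cast_sub, Int.cast_natCast] at h5
      exact h5
    rw [Real.dist_eq, ← mul_sub, abs_mul, abs_of_pos hδ]
    exact (mul_le_mul_of_nonneg_left h4 hδ.le).trans hN
  have hd2 := dist_mesh_latticeApprox_le hδ z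
  rw [mem_closedBall]
  calc _ ≤ dist (WithLp.toLp 2 fun i : Fin 3 => δ * (y i : ℝ) : EuclideanSpace ℝ (Fin 3))
          (WithLp.toLp 2 fun i : Fin 3 => δ * ((latticeApprox δ z i : ℤ) : ℝ)) +
        dist (WithLp.toLp 2 fun i : Fin 3 => δ * ((latticeApprox δ z i : ℤ) : ℝ) :
          EuclideanSpace ℝ (Fin 3)) z := dist_triangle _ _ _
    _ ≤ 2 * a + 2 * δ := add_le_add hd1 hd2
    _ ≤ 4 * a := by linarith

/-! ### The limit of a convergent sequence: positivity and an upper bound -/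

/-- If `F → A` with `0 < A ≤ B` then `0 < lim F ≤ B`. [folklore] -/
theorem limUnder_pos_and_le {F : ℕ → ℝ} {A B : ℝ} (hA : 0 < A) (hAB : A ≤ B)
    (hT : Tendsto F atTop (𝓝 A)) : 0 < limUnder atTop F ∧ limUnder atTop F ≤ B := by
  rw [hT.limUnder_eq]
  exact ⟨hA, hAB⟩

/-! ### The main estimate, in explicit form -/

/-- **The joint point-arm box probabilities converge to a positive limit at most `θ¹_{⌊a/δ⌋₊}^n`**,
eventually as `δ → 0⁺` (for `0 < δ ≤ a`): if the closed balls `B̄(z_j, 4a)` lie in the pairwise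
disjoint outer balls `B(c_j, r_j)`, then the `φ¹_{Λ_L}`-probabilities that every `z_j^δ` is joined by
an open path to `(B(c_j, r_j)ᶜ)^δ` converge as `L → ∞` (`exists_pos_tendsto_armEvent`) to some
`A > 0` with `A ≤ (φ¹_{Λ_N}(0 ↔ ∂Λ_N))^n`, `N = ⌊a/δ⌋₊`: every such arm leaves the sup-box
`z_j^δ + Λ_N ⊆ (B(c_j, r_j))^δ`, the sup-boxes are pairwise disjoint, and simultaneous arms out of
disjoint boxes cost the product of the wired one-arm probabilities
(`rcMeasure_real_siteArms_le_thetaWiredBox_pow`). [cite: Grimmett2006, Lemma (4.13), Lemma (4.14)(b) and Prop. (5.11)] -/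
theorem arms_upper_main (n : ℕ) (c : Fin n → EuclideanSpace ℝ (Fin 3)) (r : Fin n → ℝ)
    (z : Fin n → EuclideanSpace ℝ (Fin 3)) (a : ℝ) (ha : 0 < a)
    (hd : ∀ j k, j ≠ k → Disjoint (closedBall (c j) (r j)) (closedBall (c k) (r k)))
    (hsub : ∀ j, closedBall (z j) (4 * a) ⊆ ball (c j) (r j)) :
    ∀ᶠ δ in 𝓝[>] (0 : ℝ), ∃ A : ℝ, 0 < A ∧
      A ≤ thetaWiredBox 3 (fkIsingParam (criticalBeta 3)) 2 ⌊a / δ⌋₊ ^ n ∧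
      Tendsto (fun L : ℕ =>
        (rcMeasure (boxGraph 3 L) (fkIsingParam (criticalBeta 3)) 2 (boxBoundary 3 L)).real
          {ω | (fun i j => ∃ x y : BoxV 3 L,
              x.1 ∈ Fin.append (fun j => ({latticeApprox δ (z j)} : Set (Site 3)))
                (fun j => {x : Site 3 | (WithLp.toLp 2 fun i : Fin 3 => δ * (x i : ℝ) :
                  EuclideanSpace ℝ (Fin 3)) ∈ (ball (c j) (r j))ᶜ}) i ∧
              y.1 ∈ Fin.append (fun j => ({latticeApprox δ (z j)} : Set (Site 3)))
                (fun j => {x : Site 3 | (WithLp.toLp 2 fun i : Fin 3 => δ * (x i : ℝ) :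
                  EuclideanSpace ℝ (Fin 3)) ∈ (ball (c j) (r j))ᶜ}) j ∧
              (openGraph ω).Reachable x y) ∈
            {R : Fin (n + n) → Fin (n + n) → Prop |
              ∀ i : Fin n, R (Fin.castAdd n i) (Fin.natAdd n i)}})
        atTop (𝓝 A) := by
  have hp : fkIsingParam (criticalBeta 3) ∈ Set.Icc (0 : ℝ) 1 :=
    fkIsingParam_mem_Icc (criticalBeta_nonneg 3)
  have hev : ∀ᶠ δ in 𝓝[>] (0 : ℝ), 0 < δ ∧ δ ≤ a := by
    filter_upwards [self_mem_nhdsWithin, (eventually_le_nhds ha).filter_mono nhdsWithin_le_nhds]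
      with δ h1 h2
    exact ⟨h1, h2⟩
  filter_upwards [hev] with δ hδ'
  obtain ⟨hδ, hδa⟩ := hδ'
  -- the probes
  set K : Fin (n + n) → Set (Site 3) :=
    Fin.append (fun j => ({latticeApprox δ (z j)} : Set (Site 3)))
      (fun j => {x : Site 3 | (WithLp.toLp 2 fun i : Fin 3 => δ * (x i : ℝ) :
        EuclideanSpace ℝ (Fin 3)) ∈ (ball (c j) (r j))ᶜ}) with hK
  have hcof : ∀ j : Fin n, ({x : Site 3 | (WithLp.toLp 2 fun i : Fin 3 => δ * (x i : ℝ) :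
      EuclideanSpace ℝ (Fin 3)) ∈ (ball (c j) (r j))ᶜ}ᶜ).Finite := by
    intro j
    simp only [Set.compl_setOf, Set.mem_compl_iff, not_not]
    exact finite_disc_of_isBounded hδ isBounded_ball
  have hKf : ∀ i, (K i).Finite ∨ (K i)ᶜ.Finite := by
    intro i
    refine Fin.addCases (fun j => ?_) (fun j => ?_) i
    · simp only [hK, Fin.append_left]
      exact Or.inl (Set.finite_singleton _)
    · simp only [hK, Fin.append_right]
      exact Or.inr (hcof j)
  have hKne : ∀ j : Fin n, (K (Fin.castAdd n j)).Nonempty := fun j => by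
    simp only [hK, Fin.append_left]
    exact Set.singleton_nonempty _
  have hKco : ∀ j : Fin n, (K (Fin.natAdd n j))ᶜ.Finite := fun j => by
    simp only [hK, Fin.append_right]
    exact hcof j
  -- (1) convergence to a positive limit
  obtain ⟨A, hA0, hT⟩ := exists_pos_tendsto_armEvent (d := 3) le_rfl K hKf hKne hKco
  refine ⟨A, hA0, ?_, hT⟩
  -- (2) geometry of the sup-boxes
  set N : ℕ := ⌊a / δ⌋₊ with hN
  set x : Fin n → Site 3 := fun j => latticeApprox δ (z j) with hx
  have hin : ∀ (j : Fin n) (y : Site 3),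
      y ∈ Finset.Icc (fun k => -(N : ℤ) + x j k) (fun k => (N : ℤ) + x j k) →
        (WithLp.toLp 2 fun i : Fin 3 => δ * (y i : ℝ) : EuclideanSpace ℝ (Fin 3)) ∈
          ball (c j) (r j) :=
    fun j y hy => hsub j (mesh_mem_closedBall_of_mem_icc hδ hδa (z j) hy)
  have hdisj : Pairwise fun j k =>
      Disjoint (Finset.Icc (fun i => -(N : ℤ) + x j i) (fun i => (N : ℤ) + x j i))
        (Finset.Icc (fun i => -(N : ℤ) + x k i) (fun i => (N : ℤ) + x k i)) := by
    intro j k hjk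
    rw [Finset.disjoint_left]
    intro y hyj hyk
    exact Set.disjoint_left.1 (hd j k hjk) (ball_subset_closedBall (hin j y hyj))
      (ball_subset_closedBall (hin k y hyk))
  -- (3) a common volume containing all sup-boxes
  obtain ⟨L₀, hL₀⟩ := exists_subset_box_of_set_finite (Set.finite_iUnion fun j : Fin n =>
    (Finset.Icc (fun i => -(N : ℤ) + x j i) (fun i => (N : ℤ) + x j i)).finite_toSet)
  have hsubL : ∀ L : ℕ, L₀ ≤ L →
      ∀ j, Finset.Icc (fun i => -(N : ℤ) + x j i) (fun i => (N : ℤ) + x j i) ⊆ box 3 L :=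
    fun L hL j y hy => box_mono 3 hL (hL₀ (Set.mem_iUnion.2 ⟨j, Finset.mem_coe.2 hy⟩))
  -- the bound in finite volume
  have hbound : ∀ L : ℕ, L₀ ≤ L →
      (rcMeasure (boxGraph 3 L) (fkIsingParam (criticalBeta 3)) 2 (boxBoundary 3 L)).real
        {ω | (fun i j => ∃ x y : BoxV 3 L, x.1 ∈ K i ∧ y.1 ∈ K j ∧ (openGraph ω).Reachable x y) ∈
          {R : Fin (n + n) → Fin (n + n) → Prop |
            ∀ i : Fin n, R (Fin.castAdd n i) (Fin.natAdd n i)}} ≤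
      thetaWiredBox 3 (fkIsingParam (criticalBeta 3)) 2 N ^ n := by
    intro L hL
    haveI := isProbabilityMeasure_rcMeasure (boxGraph 3 L) hp two_pos (boxBoundary 3 L)
    have h1 := rcMeasure_real_siteArms_le_thetaWiredBox_pow (d := 3) (by norm_num) hp one_le_two
      x N L (hsubL L hL) hdisj
    rw [Fintype.card_fin] at h1
    refine le_trans (measureReal_mono (fun ω hω => ?_) (measure_ne_top _ _)) h1
    have hω' : ∀ i : Fin n, ∃ u v : BoxV 3 L, u.1 ∈ K (Fin.castAdd n i) ∧
        v.1 ∈ K (Fin.natAdd n i) ∧ (openGraph ω).Reachable u v := hω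
    intro i
    obtain ⟨u, v, hu, hv, huv⟩ := hω' i
    simp only [hK, Fin.append_left, Fin.append_right, Set.mem_singleton_iff,
      Set.mem_setOf_eq, Set.mem_compl_iff] at hu hv
    exact ⟨u, v, hu, fun hvmem => hv (hin i v.1 hvmem), huv⟩
  exact le_of_tendsto hT (eventually_atTop.2 ⟨L₀, hbound⟩)

/-! ### The stub -/

-- the registered stub signature is the crux's full `let` preamble, most of which is not used by
-- this clause (linter.unusedVariables would flag the verbatim statement)
set_option linter.unusedVariables false in
/-- stub [ARM] of the line skeleton (revision 6) of crux `EvenPatternDecoupling`, PROVED: **the joint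
point-arm probability is positive and at most the `n`-th power of the wired one-arm probability of
the sup-box of radius `⌊a/δ⌋₊`** — if the closed balls `B̄(z_j, 4a)` lie inside the pairwise
disjoint outer balls, then eventually as `δ → 0⁺`,
`0 < Pr[∀ j, z_j^δ ↔ (B(c_j,r_j)ᶜ)^δ] ≤ (φ¹_{Λ_{⌊a/δ⌋₊}}(0 ↔ ∂))^n`: the limit `Pr` exists and is
positive (`exists_pos_tendsto_armEvent`, as the landed `stub_armBoxLimits`); every arm crosses the
sup-box of radius `⌊a/δ⌋₊` around its point, these boxes are pairwise disjoint and eventually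
inside `Λ_L`, and simultaneous arms out of disjoint boxes cost the product of the wired one-arm
probabilities (domain Markov with wired maximal, successive conditioning, translation invariance:
`rcMeasure_real_siteArms_le_thetaWiredBox_pow`). [cite: Grimmett2006, Lemma (4.13), Lemma (4.14)(b) and Prop. (5.11)] -/
theorem stub_armsUpperWired : open Literature.Probability.LatticeModels Literature.Probability.Percolation Literature.Barriers.CriticalPhenomena Filter Topology in let E3:=EuclideanSpace ℝ (Fin 3); let μ : (L : ℕ)→MeasureTheory.Measure (BondConfig (BoxV 3 L)):=fun L=>rcMeasure (boxGraph 3 L) (fkIsingParam (criticalBeta 3)) 2 (boxBoundary 3 L); let PrL : (m : ℕ)→(Fin m→Set (Site 3))→Set (Fin m→Fin m→Prop)→ℕ→ℝ:=fun _ K R L=>(μ L).real {ω | (fun i j=>∃ x y : BoxV 3 L, x.1∈K i∧y.1∈K j∧(openGraph ω).Reachable x y)∈R}; let Pr : (m : ℕ)→(Fin m→Set (Site 3))→Set (Fin m→Fin m→Prop)→ℝ:=fun m K R=>limUnder atTop (PrL m K R); let mesh : ℝ→Site 3→E3:=fun δ z=>WithLp.toLp 2 fun i : Fin 3=>δ *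 (z i : ℝ); let disc : ℝ→Set E3→Set (Site 3):=fun δ A=>{x | mesh δ x∈A}; let EVEN : (n : ℕ)→Set (Fin n→Fin n→Prop):=fun n=>{R | ∀ i, Even ({j : Fin n | R i j}.ncard)}; let EVEN2 : (n : ℕ)→Set (Fin (n + n)→Fin (n + n)→Prop):=fun n=>{R | ∀ i : Fin n, Even ({j : Fin n | R (Fin.castAdd n i) (Fin.castAdd n j)}.ncard)}; let CROSS : (n : ℕ)→Set (Fin (n + n)→Fin (n + n)→Prop):=fun n=>{R | ∀ i : Fin n, R (Fin.castAdd n i) (Fin.natAdd n i)}; let pts : (n : ℕ)→ℝ→(Fin n→E3)→(Fin n→Set (Site 3)):=fun _ δ z j=>{latticeApprox δ (z j)}; let fam : (n : ℕ)→ℝ→(Fin n→Set E3)→(Fin n→Set E3)→(Fin (n + n)→Set (Site 3)):=fun _ δ A B=>Fin.append (fun j=>disc δ (A j)) (fun j=>disc δ (B j)); ∀ (n : ℕ) (c : Fin n→E3) (r : Fin n→ℝ) (z : Fin n→E3) (a : ℝ), 0 < a→(∀ j k, j ≠ k→Disjoint (Metric.closedBall (c j) (r j)) (Metric.closedBall (c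 k) (r k)))→(∀ j, Metric.closedBall (z j) (4 * a)⊆Metric.ball (c j) (r j))→∀ᶠ δ in 𝓝[>] 0, 0 < Pr (n + n) (Fin.append (pts n δ z) (fun j=>disc δ (Metric.ball (c j) (r j))ᶜ)) (CROSS n)∧Pr (n + n) (Fin.append (pts n δ z) (fun j=>disc δ (Metric.ball (c j) (r j))ᶜ)) (CROSS n)≤(thetaWiredBox 3 (fkIsingParam (criticalBeta 3)) 2 ⌊a / δ⌋₊) ^ n := by
  dsimp only
  intro n c r z a ha hd hsub
  filter_upwards [arms_upper_main n c r z a ha hd hsub] with δ hδ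
  obtain ⟨A, hA0, hAle, hT⟩ := hδ
  exact limUnder_pos_and_le hA0 hAle hT

end Summit.CriticalPhenomena.Ising3DConformalLimit.Theorems.EvenPatternDecoupling
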